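import Summits.CriticalPhenomena.PercolationContinuityZ3.Theorems.PercNearOneGluingNoHeavyLowerTailClubPsi
import Summits.CriticalPhenomena.PercolationContinuityZ3.Theorems.PercNearOneGluingNoHeavyLowerTailQ7PsiSetObserverGluedQ9
import HarnessLib

/-!
# `NoHeavyLowerTail` (stmt-CriticalPhenomena-4575) — CLUB at the event level: prim-lf-3's quantitative glued Question 9, `CLUB(c)`

Support file (prover `prim-cplus-coupling`, gen 16; `--supports stmt-CriticalPhenomena-4575`); no definitions, named facts
or sorries.  Cell memos prim-cplus-coupling A5-COUPLING-gen16.md §4, prim-lf-3 LF3-BETA-R.md §18d (CLUB(c), G-form).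

`N ∌ b` an observer set, `x, y, z ≠ b` relays with `μ(z↔b) ≤ μ(x↔b), μ(y↔b)` in `G` (UNGLUED designation), all weights `< 1`:
`ClubPsi.club_event` —
`μ({z↔b} ∪ ({N↔z} ∩ {N↔b})) ≤ μ({N↔b} ∩ {N↔{x,y,z}}) + μ({x↔b} ∩ {N↮b} ∩ {N↮x} ∩ {N↮y} ∩ {N↮z})`,
i.e. in `R = G/N` with `o = [N]`: `a_z^R ≤ μ_R(o↔b, o↔A) + μ_R(x↔b, o↮b,x,y,z)` — the hypothesis of prim-lf-3's socket
`UpsetExchange.spectatorExchange_of_isolationBound` (regime-I hard core of the 2+m kernel), and a sharpening of the glued (41)@3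
`Q7Psi.gluedPreFKG_three` off `{N↔A}`.  Proof: `ClubPsi.clubPsi` on `G ∖ b` for the green function of `b` (bridges
`Q7Psi.real_inter_openConn_eq_integral_green`, `Q7Psi.real_inter_setReach_eq_integral_green`, as in `Q7Psi.gluedPreFKG_three_of_gpsiGlued`)
and event algebra: on `{N↔z off b}` the left event is `{N↔b}`; off it, it is `{z↔b}`; `{x↔b} ∩ {N↮A off b}` splits into the part with
`N↮b` (then `N↮A` in `G`) and a part inside `{N↔b} ∩ ({N↔A} ∖ {N↔A off b})`.
[cite: KozmaNitzan2024, Question 9 (p. 36), (9) (pp. 9–10), §5.1 (pp. 31–32)] [cite: VandenbergHaggstromKahn2005, Thm 1.3 (p. 6)]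
-/

namespace Summit.CriticalPhenomena.PercolationContinuityZ3.Theorems

open MeasureTheory Set Literature.Probability.LatticeModels Literature.Probability.Percolation
open scoped Classical
open KNPreFKG

noncomputable section

namespace ClubPsi

open Q7Psi

universe u

variable {V : Type u} [Fintype V]

/-- **CLUB at the event level** (`CLUB(c)` of prim-lf-3 LF3-BETA-R §18d, G-form with the observer SET `N`; all weights `< 1`,
`b ∉ N`, `x, y, z ≠ b`, `y ≠ x`, `y ≠ z`, `x ≠ z`, and `μ(z↔b) ≤ μ(x↔b)`, `μ(z↔b) ≤ μ(y↔b)`):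
`μ({z↔b} ∪ ({N↔z} ∩ {N↔b})) ≤ μ({N↔b} ∩ {N↔{x,y,z}}) + μ({x↔b} ∩ {N↮b} ∩ {N↮x} ∩ {N↮y} ∩ {N↮z})`.
From `ClubPsi.clubPsi` on `G ∖ b` at the green function of `b`. [cite: KozmaNitzan2024, Question 9 (p. 36), (9) (pp. 9–10)] -/
theorem club_event (w : Sym2 V → unitInterval) (hw : ∀ e, w e < 1) (N : Set V) (b x y z : V) (hbN : b ∉ N)
    (hxb : x ≠ b) (hyb : y ≠ b) (hzb : z ≠ b) (hyx : y ≠ x) (hyz : y ≠ z) (hxz : x ≠ z)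
    (hzx : (prodBernoulli w).real (openConn z b) ≤ (prodBernoulli w).real (openConn x b))
    (hzy : (prodBernoulli w).real (openConn z b) ≤ (prodBernoulli w).real (openConn y b)) :
    (prodBernoulli w).real (openConn z b ∪ ({ω : BondConfig V | ∃ n ∈ N, (openGraph ω).Reachable n z} ∩
        {ω : BondConfig V | ∃ n ∈ N, (openGraph ω).Reachable n b})) ≤
      (prodBernoulli w).real ({ω : BondConfig V | ∃ n ∈ N, (openGraph ω).Reachable n b} ∩
          ⋃ a ∈ ({x, y, z} : Finset V), {ω : BondConfig V | ∃ n ∈ N, (openGraph ω).Reachable n a}) +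
        (prodBernoulli w).real (openConn x b ∩ ({ω : BondConfig V | ∀ n ∈ N, ¬ (openGraph ω).Reachable n b} ∩
          ({ω | ∀ n ∈ N, ¬ (openGraph ω).Reachable n x} ∩ ({ω | ∀ n ∈ N, ¬ (openGraph ω).Reachable n y} ∩
            {ω | ∀ n ∈ N, ¬ (openGraph ω).Reachable n z})))) := by
  classical
  set μ := prodBernoulli w with hμ
  have hmeas : ∀ T : Set (BondConfig V), MeasurableSet T := fun _ => MeasurableSet.of_discrete
  set Ob : Set (BondConfig V) := {ω : BondConfig V | ∃ n ∈ N, (openGraph ω).Reachable n b} with hOb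
  set Oz : Set (BondConfig V) := {ω : BondConfig V | ∃ n ∈ N, (openGraph ω).Reachable n z} with hOz
  set L : Set (BondConfig V) := openConn z b ∪ (Oz ∩ Ob) with hL
  set UA : Set (BondConfig V) := ⋃ a ∈ ({x, y, z} : Finset V), {ω : BondConfig V | ∃ n ∈ N, (openGraph ω).Reachable n a}
    with hUA
  set EN : Set (BondConfig V) := {ω : BondConfig V | ∀ n ∈ N, ¬ (openGraph ω).Reachable n b} ∩
    ({ω | ∀ n ∈ N, ¬ (openGraph ω).Reachable n x} ∩ ({ω | ∀ n ∈ N, ¬ (openGraph ω).Reachable n y} ∩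
      {ω | ∀ n ∈ N, ¬ (openGraph ω).Reachable n z})) with hEN
  show μ.real L ≤ μ.real (Ob ∩ UA) + μ.real (openConn x b ∩ EN)
  set Jx : Set (BondConfig V) := {ω : BondConfig V | ∃ n ∈ N, ω ∈ openConnIn ({b}ᶜ : Set V) n x} with hJx
  set Jy : Set (BondConfig V) := {ω : BondConfig V | ∃ n ∈ N, ω ∈ openConnIn ({b}ᶜ : Set V) n y} with hJy
  set Jz : Set (BondConfig V) := {ω : BondConfig V | ∃ n ∈ N, ω ∈ openConnIn ({b}ᶜ : Set V) n z} with hJz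
  set JA : Set (BondConfig V) := (Jx ∪ Jy) ∪ Jz with hJA
  have hnb : ∀ n ∈ N, n ≠ b := fun n hn h => hbN (h ▸ hn)
  -- measure splitting along an event
  have msplit : ∀ X Y : Set (BondConfig V), μ.real X = μ.real (X ∩ Y) + μ.real (X ∩ Yᶜ) := by
    intro X Y
    rw [← measureReal_inter_add_sdiff (μ := μ) (s := X) (hmeas Y)]
    rfl
  -- (1) on `J_z` the left event is `{N↔b}`; off `J_z` it is `{z↔b}`
  have hLJz : L ∩ Jz = Ob ∩ Jz := by
    ext ω
    simp only [hL, hOb, hOz, hJz, mem_inter_iff, mem_union, mem_setOf_eq]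
    constructor
    · rintro ⟨hLω, n, hn, hnz⟩
      refine ⟨?_, n, hn, hnz⟩
      rcases hLω with hzb' | ⟨_, hb'⟩
      · exact ⟨n, hn, (reachable_of_openConnIn hnz).trans hzb'⟩
      · exact hb'
    · rintro ⟨hb', n, hn, hnz⟩
      exact ⟨Or.inr ⟨⟨n, hn, reachable_of_openConnIn hnz⟩, hb'⟩, n, hn, hnz⟩
  have hLJzc : L ∩ Jzᶜ = openConn z b ∩ Jzᶜ := by
    ext ω
    simp only [hL, hOb, hOz, hJz, mem_inter_iff, mem_union, mem_compl_iff, mem_setOf_eq, not_exists, not_and]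
    constructor
    · rintro ⟨hLω, hnJ⟩
      refine ⟨?_, hnJ⟩
      rcases hLω with hzb' | ⟨⟨n, hn, hnz⟩, _⟩
      · exact hzb'
      · exact hnz.symm.trans (reachable_of_not_openConnIn_compl hnz (hnJ n hn))
    · rintro ⟨hzb', hnJ⟩
      exact ⟨Or.inl hzb', hnJ⟩
  -- (2) pass to `G ∖ b`
  set S : Set V := {b}ᶜ with hS
  set r := restrictConfig (Subtype.val : S → V) with hr
  set w' : Sym2 S → unitInterval := w ∘ Sym2.map (Subtype.val : S → V) with hw'
  set μ' := prodBernoulli w' with hμ'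
  set x' : S := ⟨x, mem_compl_singleton_iff.2 hxb⟩ with hx'
  set y' : S := ⟨y, mem_compl_singleton_iff.2 hyb⟩ with hy'
  set z' : S := ⟨z, mem_compl_singleton_iff.2 hzb⟩ with hz'
  set N' : Set S := (Subtype.val : S → V) ⁻¹' N with hN'
  set Jx' : Set (BondConfig S) := {ω' : BondConfig S | ∃ n ∈ N', (openGraph ω').Reachable x' n} with hJx'
  set Jy' : Set (BondConfig S) := {ω' : BondConfig S | ∃ n ∈ N', (openGraph ω').Reachable y' n} with hJy'
  set Ex' : Set (BondConfig S) := {ω' | ∀ n ∈ N', ¬ (openGraph ω').Reachable x' n} with hEx'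
  set Ey' : Set (BondConfig S) := {ω' | ∀ n ∈ N', ¬ (openGraph ω').Reachable y' n} with hEy'
  set Ez' : Set (BondConfig S) := {ω' | ∀ n ∈ N', ¬ (openGraph ω').Reachable z' n} with hEz'
  set J₀ : Set (BondConfig S) := (Jx' ∪ Jy') ∩ Ez' with hJ₀
  set E₀ : Set (BondConfig S) := Ex' ∩ (Ey' ∩ Ez') with hE₀
  have hJpre : ∀ (v : V) (hvb : v ≠ b),
      {ω : BondConfig V | ∃ n ∈ N, ω ∈ openConnIn ({b}ᶜ : Set V) n v} =
        r ⁻¹' {ω' : BondConfig S | ∃ n ∈ N', (openGraph ω').Reachable ⟨v, mem_compl_singleton_iff.2 hvb⟩ n} := by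
    intro v hvb; ext ω
    simp only [mem_setOf_eq, mem_preimage, hN']
    constructor
    · rintro ⟨n, hn, h⟩
      refine ⟨⟨n, mem_compl_singleton_iff.2 (hnb n hn)⟩, hn, ?_⟩
      rw [reachable_restrictConfig_val_iff]
      rw [openConnIn_comm]; exact h
    · rintro ⟨n', hn', h⟩
      refine ⟨n', hn', ?_⟩
      rw [reachable_restrictConfig_val_iff] at h
      rw [openConnIn_comm]; exact h
  have hEpre : ∀ (v : V) (hvb : v ≠ b),
      {ω : BondConfig V | ∃ n ∈ N, ω ∈ openConnIn ({b}ᶜ : Set V) n v}ᶜ =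
        r ⁻¹' {ω' : BondConfig S | ∀ n ∈ N', ¬ (openGraph ω').Reachable ⟨v, mem_compl_singleton_iff.2 hvb⟩ n} := by
    intro v hvb
    rw [hJpre v hvb, ← preimage_compl]
    congr 1
    ext ω'
    simp only [mem_compl_iff, mem_setOf_eq, not_exists, not_and]
  have hJ₀pre : (Jx ∪ Jy) ∩ Jzᶜ = r ⁻¹' J₀ := by
    rw [hJ₀, preimage_inter, preimage_union, hJx, hJy, hJz, hJpre x hxb, hJpre y hyb, hEpre z hzb]
  have hE₀pre : Jxᶜ ∩ (Jyᶜ ∩ Jzᶜ) = r ⁻¹' E₀ := by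
    rw [hE₀, preimage_inter, preimage_inter, hJx, hJy, hJz, hEpre x hxb, hEpre y hyb, hEpre z hzb]
  -- the green function and the bridges (as in `Q7Psi.gluedPreFKG_three_of_gpsiGlued`)
  set F : Set S → ℝ := fun T => μ.real {ω₁ : BondConfig V | ∃ s ∈ Subtype.val '' T, s ≠ b ∧ s(b, s) ∈ ω₁} with hF
  have hFmono : ∀ T T' : Set S, T ⊆ T' → F T ≤ F T' := by
    intro T T' hTT'
    refine measureReal_mono fun ω₁ hω₁ => ?_
    obtain ⟨s, hs, hsb, hso⟩ := hω₁
    exact ⟨s, image_mono hTT' hs, hsb, hso⟩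
  have hF0 : ∀ T : Set S, 0 ≤ F T := fun T => measureReal_nonneg
  have hbridge : ∀ (v : V) (hvb : v ≠ b) (E₁ : Set (BondConfig S)),
      μ.real (openConn v b ∩ r ⁻¹' E₁) = ∫ ω' in E₁, F (openCluster ω' ⟨v, mem_compl_singleton_iff.2 hvb⟩) ∂μ' := by
    intro v hvb E₁
    rw [inter_comm, hr, real_inter_openConn_eq_integral_green w b v hvb E₁, ← integral_indicator (hmeas _),
      hμ', hw', ← integral_indicator (MeasurableSet.of_discrete), ← integral_comp_restrictConfig_val]
    refine integral_congr_ae (Filter.Eventually.of_forall fun ω => ?_)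
    change (restrictConfig Subtype.val ⁻¹' E₁).indicator _ ω = E₁.indicator _ (restrictConfig Subtype.val ω)
    have hfun : (fun ω : BondConfig V => μ.real {ω₁ : BondConfig V | ∃ s ∈ {y | ω ∈ openConnIn ({b}ᶜ : Set V) v y},
        s ≠ b ∧ s(b, s) ∈ ω₁}) =
        (fun ω' => F (openCluster ω' ⟨v, mem_compl_singleton_iff.2 hvb⟩)) ∘ restrictConfig (Subtype.val : S → V) := by
      funext ω
      simp only [Function.comp_apply, hF]
      rw [setOf_openConnIn_eq_image b ω ⟨v, mem_compl_singleton_iff.2 hvb⟩]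
    rw [hfun]
    exact indicator_comp_right _
  have hsetcl : ∀ ω : BondConfig V, {y | ∃ n ∈ N, ω ∈ openConnIn ({b}ᶜ : Set V) n y} =
      Subtype.val '' ⋃ n ∈ N', openCluster (restrictConfig (Subtype.val : S → V) ω) n := by
    intro ω
    rw [image_iUnion₂]
    ext v
    simp only [mem_setOf_eq, mem_iUnion, hN', mem_preimage, exists_prop]
    constructor
    · rintro ⟨n, hn, h⟩
      refine ⟨⟨n, mem_compl_singleton_iff.2 (hnb n hn)⟩, hn, ?_⟩
      rw [← setOf_openConnIn_eq_image b ω ⟨n, _⟩]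
      exact h
    · rintro ⟨n', hn', h⟩
      refine ⟨n', hn', ?_⟩
      rw [← setOf_openConnIn_eq_image b ω n'] at h
      exact h
  have hbridgeN : ∀ (E₁ : Set (BondConfig S)),
      μ.real (Ob ∩ r ⁻¹' E₁) = ∫ ω' in E₁, F (⋃ n ∈ N', openCluster ω' n) ∂μ' := by
    intro E₁
    rw [inter_comm, hr, hOb, real_inter_setReach_eq_integral_green w b N hbN E₁, ← integral_indicator (hmeas _),
      hμ', hw', ← integral_indicator (MeasurableSet.of_discrete), ← integral_comp_restrictConfig_val]
    refine integral_congr_ae (Filter.Eventually.of_forall fun ω => ?_)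
    change (restrictConfig Subtype.val ⁻¹' E₁).indicator _ ω = E₁.indicator _ (restrictConfig Subtype.val ω)
    have hfun : (fun ω : BondConfig V => μ.real {ω₁ : BondConfig V | ∃ s ∈ {y | ∃ n ∈ N, ω ∈ openConnIn ({b}ᶜ : Set V) n y},
        s ≠ b ∧ s(b, s) ∈ ω₁}) =
        (fun ω' => F (⋃ n ∈ N', openCluster ω' n)) ∘ restrictConfig (Subtype.val : S → V) := by
      funext ω
      simp only [Function.comp_apply, hF]
      rw [hsetcl ω]
    rw [hfun]
    exact indicator_comp_right _
  have htau : ∀ (v : V) (hvb : v ≠ b), μ.real (openConn v b) =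
      ∫ ω', F (openCluster ω' ⟨v, mem_compl_singleton_iff.2 hvb⟩) ∂μ' := by
    intro v hvb
    rw [← setIntegral_univ, ← hbridge v hvb univ, preimage_univ, inter_univ]
  have hx'' : ∫ ω', F (openCluster ω' z') ∂μ' ≤ ∫ ω', F (openCluster ω' x') ∂μ' := by
    rw [← htau z hzb, ← htau x hxb]; exact hzx
  have hy'' : ∫ ω', F (openCluster ω' z') ∂μ' ≤ ∫ ω', F (openCluster ω' y') ∂μ' := by
    rw [← htau z hzb, ← htau y hyb]; exact hzy
  -- non-degeneracy in `G ∖ b`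
  have hw'1 : ∀ e, w' e < 1 := fun e => hw _
  have hyx' : y' ≠ x' := fun h => hyx (congrArg Subtype.val h)
  have hyz' : y' ≠ z' := fun h => hyz (congrArg Subtype.val h)
  have hxy' : x' ≠ y' := fun h => hyx (congrArg Subtype.val h).symm
  have hxz' : x' ≠ z' := fun h => hxz (congrArg Subtype.val h)
  have hzx' : z' ≠ x' := fun h => hxz (congrArg Subtype.val h).symm
  have hpEx := real_not_reachable_pair_pos w' hw'1 hxy' hxz'
  have hpE2 := real_not_reachable_pair_pos w' hw'1 hyx' hyz'
  have hzy' : z' ≠ y' := fun h => hyz (congrArg Subtype.val h).symm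
  have hpDzx : 0 < μ'.real {η : BondConfig S | ¬ (openGraph η).Reachable z' x'} :=
    lt_of_lt_of_le (real_not_reachable_pair_pos w' hw'1 hzx' hzy') (measureReal_mono inter_subset_left)
  -- CLUB-Ψ on `G ∖ b` at the green function
  have hclub := clubPsi w' x' y' z' N' hyx' hyz' hpEx hpE2 hpDzx F hFmono hF0 hx'' hy''
  change (∫ ω' in J₀, F (openCluster ω' z') ∂μ') + ∫ ω' in E₀, F (openCluster ω' z') ∂μ' ≤
    (∫ ω' in J₀, F (⋃ n ∈ N', openCluster ω' n) ∂μ') + ∫ ω' in E₀, F (openCluster ω' x') ∂μ' at hclub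
  rw [← hbridge z hzb J₀, ← hbridge z hzb E₀, ← hbridgeN J₀, ← hbridge x hxb E₀, ← hJ₀pre, ← hE₀pre] at hclub
  -- (3) event algebra
  -- `μ(L) = μ(Ob ∩ Jz) + μ(zb ∩ Jzᶜ)` and `μ(zb ∩ Jzᶜ) = μ(zb ∩ (Jx∪Jy) ∩ Jzᶜ) + μ(zb ∩ Jxᶜ∩Jyᶜ∩Jzᶜ)`
  have s1 := msplit L Jz
  rw [hLJz, hLJzc] at s1
  have s2 : μ.real (openConn z b ∩ Jzᶜ) =
      μ.real (openConn z b ∩ ((Jx ∪ Jy) ∩ Jzᶜ)) + μ.real (openConn z b ∩ (Jxᶜ ∩ (Jyᶜ ∩ Jzᶜ))) := by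
    rw [msplit (openConn z b ∩ Jzᶜ) (Jx ∪ Jy)]
    congr 1
    · congr 1; ext ω; simp only [mem_inter_iff, mem_union, mem_compl_iff]; tauto
    · congr 1; ext ω; simp only [mem_inter_iff, mem_union, mem_compl_iff, not_or]; tauto
  -- `μ(Ob ∩ Jz) + μ(Ob ∩ (Jx∪Jy) ∩ Jzᶜ) = μ(Ob ∩ JA)`
  have s3 : μ.real (Ob ∩ Jz) + μ.real (Ob ∩ ((Jx ∪ Jy) ∩ Jzᶜ)) = μ.real (Ob ∩ JA) := by
    rw [msplit (Ob ∩ JA) Jz]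
    congr 1
    · congr 1; ext ω; simp only [hJA, mem_inter_iff, mem_union]; tauto
    · congr 1; ext ω; simp only [hJA, mem_inter_iff, mem_union, mem_compl_iff]; tauto
  -- `JA ⊆ UA`, so `μ(Ob ∩ UA) = μ(Ob ∩ JA) + μ(Ob ∩ UA ∩ JAᶜ)`
  have hJAUA : JA ⊆ UA := by
    intro ω hω
    simp only [hJA, hJx, hJy, hJz, hUA, mem_union, mem_setOf_eq, mem_iUnion, Finset.mem_insert, Finset.mem_singleton,
      exists_prop] at hω ⊢
    rcases hω with (⟨n, hn, h⟩ | ⟨n, hn, h⟩) | ⟨n, hn, h⟩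
    · exact ⟨x, Or.inl rfl, n, hn, reachable_of_openConnIn h⟩
    · exact ⟨y, Or.inr (Or.inl rfl), n, hn, reachable_of_openConnIn h⟩
    · exact ⟨z, Or.inr (Or.inr rfl), n, hn, reachable_of_openConnIn h⟩
  have s4 : μ.real (Ob ∩ UA) = μ.real (Ob ∩ JA) + μ.real (Ob ∩ UA ∩ JAᶜ) := by
    rw [msplit (Ob ∩ UA) JA]
    congr 2
    ext ω
    simp only [mem_inter_iff]
    constructor
    · rintro ⟨⟨hO, _⟩, hJ⟩; exact ⟨hO, hJ⟩
    · rintro ⟨hO, hJ⟩; exact ⟨⟨hO, hJAUA hJ⟩, hJ⟩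
  -- `xb ∩ Jxᶜ∩Jyᶜ∩Jzᶜ` splits along `Ob`
  have s5 := msplit (openConn x b ∩ (Jxᶜ ∩ (Jyᶜ ∩ Jzᶜ))) Ob
  have h5a : μ.real (openConn x b ∩ (Jxᶜ ∩ (Jyᶜ ∩ Jzᶜ)) ∩ Ob) ≤ μ.real (Ob ∩ UA ∩ JAᶜ) := by
    apply measureReal_mono
    · rintro ω ⟨⟨hxbω, hJxc, hJyc, hJzc⟩, hObω⟩
      refine ⟨⟨hObω, ?_⟩, ?_⟩
      · obtain ⟨n, hn, hnb'⟩ := hObω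
        simp only [hUA, mem_iUnion, mem_setOf_eq, Finset.mem_insert, Finset.mem_singleton, exists_prop]
        exact ⟨x, Or.inl rfl, n, hn, hnb'.trans (hxbω : (openGraph ω).Reachable x b).symm⟩
      · simp only [hJA, mem_compl_iff, mem_union, not_or]
        exact ⟨⟨hJxc, hJyc⟩, hJzc⟩
    · exact measure_ne_top _ _
  have h5b : μ.real (openConn x b ∩ (Jxᶜ ∩ (Jyᶜ ∩ Jzᶜ)) ∩ Obᶜ) ≤ μ.real (openConn x b ∩ EN) := by
    apply measureReal_mono
    · rintro ω ⟨⟨hxbω, hJxc, hJyc, hJzc⟩, hObc⟩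
      have hnb'' : ∀ n ∈ N, ¬ (openGraph ω).Reachable n b := fun n hn h => hObc ⟨n, hn, h⟩
      have off : ∀ (v : V) (J : Set (BondConfig V)), J = {ω : BondConfig V | ∃ n ∈ N, ω ∈ openConnIn ({b}ᶜ : Set V) n v} →
          ω ∉ J → ∀ n ∈ N, ¬ (openGraph ω).Reachable n v := by
        intro v J hJ hωJ n hn hnv
        have hn' : ω ∉ openConnIn ({b}ᶜ : Set V) n v := fun h' => hωJ (hJ ▸ ⟨n, hn, h'⟩)
        exact hnb'' n hn (reachable_of_not_openConnIn_compl hnv hn')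
      exact ⟨hxbω, hnb'', off x Jx hJx hJxc, off y Jy hJy hJyc, off z Jz hJz hJzc⟩
    · exact measure_ne_top _ _
  -- assemble
  rw [s1, s2, s4]
  linarith [hclub, s3, s5, h5a, h5b]

end ClubPsi

end

end Summit.CriticalPhenomena.PercolationContinuityZ3.Theorems
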